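import Literature.Analysis.FunctionSpaces.PolchinskiSemigroup
import Mathlib.MeasureTheory.Integral.IntervalIntegral.FundThmCalculus
import Mathlib.Analysis.Calculus.Deriv.MeanValue
import Mathlib.Algebra.QuadraticDiscriminant
import HarnessLib

/-!
# Kernel rigidity of a covariance decomposition under the multiscale Bakry–Émery condition
# (Bauerschmidt–Bodineau–Dagallier, Theorem 3: the degenerate directions)

Topic `Literature/Analysis/FunctionSpaces`; companion ("proof architecture") file of
`MultiscaleBakryEmery.lean`, which TYPES [BBD, Theorem 3] as the named fact
`Polchinski.BauerschmidtBodineau_multiscaleBakryEmery`, and of `PolchinskiLogSobolevBoundedBelow.lean`,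
which PROVES Theorem 3 (`Polchinski.logSobolev_of_multiscaleBakryEmery_of_bounded_below`) for every
covariance decomposition that is NONDEGENERATE (`C_t ≻ 0` for `t > 0`).  The named fact, faithful to the
printed setting ([BBD] §3.1 p0012 L11–13, L56–61: «`t ↦ C_t` … positive SEMIdefinite matrices increasing …
to a matrix `C_∞`», `X = im C_∞`), quantifies over possibly DEGENERATE decompositions; the printed proof
does not treat them ([BBD] Prop 5's proof, p0012 L83–87, asserts that the image of `C_s` is locally constant
away from the discontinuity points of `Ċ`, which fails when a direction of `Ċ_t` switches on continuously at
a positive time).  This file closes the first half of that gap with a result that is NOT in print (own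
argument of this seat, recorded as such; presearch corpus + galaxy «multiscale Bakry|Polchinski
semigroup|degenerate covariance decomposition»: no treatment of singular `Ċ_t`):

**Kernel rigidity** (`Polchinski.quadForm_C_eq_zero_of_eq_zero`).  Under the hypotheses of the named
fact — `V₀` measurable and bounded below, `V_t ∈ C²(ℝ^N)` for every `t > 0`, the multiscale condition
(e:assCt-mon) for all `φ ∈ ℝ^N` with rates `λ̇_t`, and `λ̇` locally integrable on `[0, ∞)` — NO DIRECTION
CAN SWITCH ON AT A POSITIVE TIME: if `(v, C_{t₀} v) = 0` for one `t₀ > 0` then `(v, C_s v) = 0` for every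
`s ≥ 0`; equivalently `ker C_t = ker C_∞` for all `t > 0` (`mulVec_C_eq_zero_iff_mulVec_Cinf_eq_zero`).
Hence, under those hypotheses, a decomposition is nondegenerate on `X = (ker C_∞)ᗮ`, which is where the
sibling `PolchinskiSubspaceReduction.lean` transports the nondegenerate theorem.

Mechanism (all steps proved here).  Suppose `Q(t) = (v, C_t v)` vanishes at `t₀ > 0` but not identically;
let `a ≥ t₀` be its last zero, so `a > 0`, `q = Q' = (v, Ċ_t v) ≥ 0` vanishes on `[0, a]` and `V_a ∈ C²`.
(E1) By the semigroup of potentials `e^{−V_t(ψ)} = E_{C_t−C_a}[e^{−V_a(ψ+ζ)}]`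
(`exp_neg_renormPotential_eq_integral_sub`), continuity of `V_a` and the Chebyshev bound
`P_{C_t−C_a}(‖ζ‖ > 1) ≤ tr(C_t − C_a) → 0`, the potentials `V_t` are bounded, locally in space, uniformly for
`t ∈ [a, a+η]` (`exists_renormPotential_le_near`).  (E2) A `C²` function bounded by `K` on a segment
`[−w, w]` has a point of that segment where `Hess V(φ)(w, w) ≤ 4K` (`exists_fderiv_fderiv_le_of_abs_le`, strict
convexity of `σ ↦ V(σw) − 2Kσ²` otherwise); with `w_t = Ċ_t v/√q(t)`, whose norm is bounded by
`‖Ċ_t v‖² ≤ tr(Ċ_t)·q(t)` (`sum_mulVec_sq_le_trace_mul_quadForm`, Cauchy–Schwarz for the semi-inner product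
of a positive semidefinite matrix), the multiscale condition at that point reads `q′ ≤ 2(4K − λ̇_t) q` on
`(a, a+η]`.  (E3) From a point `m` with `q(m) > 0` back to the last zero `z ≥ a` of `q` before `m`,
`log q(m) − log q(t) ≤ ∫_t^m 2(4K − λ̇)` by the one-sided fundamental-theorem INEQUALITY
`intervalIntegral.sub_le_integral_of_hasDeriv_right_of_le` (no integrability of `q′` is needed), so `q` is
bounded away from `0` on `(z, m]`, contradicting `q(z) = 0`.  Sanity check of the phenomenon: for `N = 1`,
`V₀ = 0`, `Ċ_t = (t−a)² e^{−(t−a)}` (`t ≥ a`) the multiscale condition forces `λ̇_t ≤ −1/(t−a) + ½`, which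
is not locally integrable — the named fact is vacuous on such decompositions, as it must be for the theorem
to hold in the degenerate generality in which it is printed.

No new definition, no new named fact; nothing here is a statement about Yang–Mills or lattice gauge theory.

## References

* [BauerschmidtBodineauDagallier2023] R. Bauerschmidt, T. Bodineau, B. Dagallier, *Stochastic dynamics
  and the Polchinski equation: an introduction*, Probab. Surveys 21 (2024) 200–290, arXiv:2307.07619 —
  §3.1 p0012 (setting: positive semidefinite `C_t`, `X = im C_∞`; Prop 5 and its proof), Def 2 p0013,
  Theorem 3 p0015 L62–90. READ (held text `paper:arxiv-2307.07619`).
* [BauerschmidtBodineau2021SineGordonLSI] R. Bauerschmidt, T. Bodineau, Comm. Pure Appl. Math. 74 (2021)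
  2064–2113 — the criterion. READ (held text).
-/

noncomputable section

open MeasureTheory ProbabilityTheory Filter Topology Set
open scoped RealInnerProductSpace Matrix MatrixOrder

namespace Literature.Analysis.FunctionSpaces

namespace Polchinski

/-! ### Positive semidefinite matrices: Cauchy–Schwarz and the trace bound `‖Av‖² ≤ tr(A)·(v, Av)` -/

section PSD

variable {n : Type*} [Fintype n] [DecidableEq n]

omit [DecidableEq n] in
/-- The quadratic form of a positive semidefinite real matrix is symmetric: `(x, Ay) = (y, Ax)`.
[folklore] -/
private theorem dotProduct_mulVec_comm_of_posSemidef {A : Matrix n n ℝ} (hA : A.PosSemidef) (x y : n → ℝ) :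
    x ⬝ᵥ (A *ᵥ y) = y ⬝ᵥ (A *ᵥ x) := by
  have hT : Aᵀ = A := by
    have h := hA.1
    rw [Matrix.IsHermitian, Matrix.conjTranspose_eq_transpose_of_trivial] at h
    exact h
  calc x ⬝ᵥ (A *ᵥ y) = (x ᵥ* A) ⬝ᵥ y := Matrix.dotProduct_mulVec x A y
    _ = (Aᵀ *ᵥ x) ⬝ᵥ y := by rw [Matrix.mulVec_transpose]
    _ = y ⬝ᵥ (A *ᵥ x) := by rw [hT, dotProduct_comm]

omit [DecidableEq n] in
/-- **Cauchy–Schwarz for the semi-inner product of a positive semidefinite matrix**: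
`(x, Ay)² ≤ (x, Ax)(y, Ay)` (discriminant of `s ↦ (x − sy, A(x − sy)) ≥ 0`). [folklore] -/
private theorem dotProduct_mulVec_sq_le_of_posSemidef {A : Matrix n n ℝ} (hA : A.PosSemidef) (x y : n → ℝ) :
    (x ⬝ᵥ (A *ᵥ y)) ^ 2 ≤ (x ⬝ᵥ (A *ᵥ x)) * (y ⬝ᵥ (A *ᵥ y)) := by
  have hq : ∀ s : ℝ, 0 ≤ (y ⬝ᵥ (A *ᵥ y)) * (s * s) + (-(2 * (x ⬝ᵥ (A *ᵥ y)))) * s +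
      x ⬝ᵥ (A *ᵥ x) := by
    intro s
    have h := hA.dotProduct_mulVec_nonneg (x - s • y)
    rw [star_trivial] at h
    have e : (x - s • y) ⬝ᵥ (A *ᵥ (x - s • y)) =
        (y ⬝ᵥ (A *ᵥ y)) * (s * s) + (-(2 * (x ⬝ᵥ (A *ᵥ y)))) * s + x ⬝ᵥ (A *ᵥ x) := by
      rw [Matrix.mulVec_sub, Matrix.mulVec_smul, sub_dotProduct, dotProduct_sub, dotProduct_sub,
        dotProduct_smul, smul_dotProduct, smul_dotProduct, dotProduct_smul,
        dotProduct_mulVec_comm_of_posSemidef hA y x]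
      simp only [smul_eq_mul]
      ring
    rw [← e]
    exact h
  have hd := discrim_le_zero hq
  rw [discrim] at hd
  nlinarith [hd]

/-- The `i`-th coordinate of `Av` is the semi-inner product of `v` with the `i`-th basis vector.
[folklore] -/
private theorem mulVec_apply_eq_single_dotProduct (A : Matrix n n ℝ) (v : n → ℝ) (i : n) :
    (A *ᵥ v) i = (Pi.single i 1 : n → ℝ) ⬝ᵥ (A *ᵥ v) := by
  rw [single_dotProduct, one_mul]

/-- The diagonal entry `A i i` is the quadratic form at the `i`-th basis vector. [folklore] -/
private theorem single_dotProduct_mulVec_single (A : Matrix n n ℝ) (i : n) :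
    (Pi.single i 1 : n → ℝ) ⬝ᵥ (A *ᵥ Pi.single i 1) = A i i := by
  rw [single_dotProduct, one_mul]
  simp only [Matrix.mulVec, dotProduct, Pi.single_apply, mul_ite, mul_one, mul_zero,
    Finset.sum_ite_eq', Finset.mem_univ, if_true]

/-- **`‖Av‖² ≤ tr(A) · (v, Av)` for a positive semidefinite real matrix** (coordinatewise Cauchy–Schwarz
`(Av)_i² ≤ A_{ii} (v, Av)`, summed over `i`). [folklore] -/
private theorem sum_mulVec_sq_le_trace_mul_quadForm {A : Matrix n n ℝ} (hA : A.PosSemidef) (v : n → ℝ) :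
    ∑ i, (A *ᵥ v) i ^ 2 ≤ (∑ i, A i i) * (v ⬝ᵥ (A *ᵥ v)) := by
  rw [Finset.sum_mul]
  refine Finset.sum_le_sum fun i _ => ?_
  rw [mulVec_apply_eq_single_dotProduct, ← single_dotProduct_mulVec_single A i]
  exact dotProduct_mulVec_sq_le_of_posSemidef hA _ _

end PSD

/-! ### Gaussian moments and a Chebyshev small-ball bound for a (possibly degenerate) centred Gaussian -/

section Moments

variable {ι : Type*} [Fintype ι] [DecidableEq ι]

/-- First moments vanish: `E_S[L(w)] = 0` for a continuous linear functional `L`. [folklore] -/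
private theorem integral_clm_gaussian_eq_zero' (S : Matrix ι ι ℝ) (L : EuclideanSpace ℝ ι →L[ℝ] ℝ) :
    ∫ w, L w ∂(multivariateGaussian 0 S) = 0 := by
  rw [L.integral_comp_id_comm IsGaussian.integrable_id, integral_id_multivariateGaussian, map_zero]

/-- Coordinates are square integrable under a Gaussian. [folklore] -/
private theorem memLp_two_eval_gaussian' (S : Matrix ι ι ℝ) (k : ι) :
    MemLp (fun x : EuclideanSpace ℝ ι => x k) 2 (multivariateGaussian 0 S) := by
  have h := (EuclideanSpace.proj (𝕜 := ℝ) k).comp_memLp' (IsGaussian.memLp_id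
    (multivariateGaussian 0 S) 2 (by simp))
  simpa using h

/-- Second moments: `E_S[w_i w_j] = S_{ij}` for positive semidefinite `S`. [folklore] -/
private theorem integral_eval_mul_eval_gaussian' {S : Matrix ι ι ℝ} (hS : S.PosSemidef) (i j : ι) :
    ∫ w, w i * w j ∂(multivariateGaussian 0 S) = S i j := by
  have hcov := covariance_eval_multivariateGaussian (μ := 0) hS i j
  have hmean : ∀ k : ι, ∫ x, x k ∂(multivariateGaussian 0 S) = 0 := by
    intro k
    have h := integral_clm_gaussian_eq_zero' S (EuclideanSpace.proj (𝕜 := ℝ) k)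
    simpa using h
  rw [covariance_eq_sub (memLp_two_eval_gaussian' S i) (memLp_two_eval_gaussian' S j)] at hcov
  simpa [hmean] using hcov

/-- `‖w‖²` is integrable under a Gaussian. [folklore] -/
private theorem integrable_norm_sq_gaussian (S : Matrix ι ι ℝ) :
    Integrable (fun w : EuclideanSpace ℝ ι => ‖w‖ ^ 2) (multivariateGaussian 0 S) := by
  simp_rw [EuclideanSpace.real_norm_sq_eq]
  exact integrable_finsetSum _ fun i _ => (memLp_two_eval_gaussian' S i).integrable_sq

/-- **`E_S[‖w‖²] = tr S`** for positive semidefinite `S`. [folklore] -/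
private theorem integral_norm_sq_gaussian_eq_trace {S : Matrix ι ι ℝ} (hS : S.PosSemidef) :
    ∫ w, ‖w‖ ^ 2 ∂(multivariateGaussian 0 S) = ∑ i, S i i := by
  simp_rw [EuclideanSpace.real_norm_sq_eq]
  rw [integral_finsetSum]
  · refine Finset.sum_congr rfl fun i _ => ?_
    have h := integral_eval_mul_eval_gaussian' hS i i
    simpa [pow_two] using h
  · intro i _
    exact (memLp_two_eval_gaussian' S i).integrable_sq

/-- **Chebyshev small-ball bound**: `P_S(‖w‖ > 1) ≤ tr S` for positive semidefinite `S`. [folklore] -/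
private theorem measureReal_one_lt_norm_gaussian_le_trace {S : Matrix ι ι ℝ} (hS : S.PosSemidef) :
    (multivariateGaussian 0 S).real {w | 1 < ‖w‖} ≤ ∑ i, S i i := by
  have hsub : {w : EuclideanSpace ℝ ι | 1 < ‖w‖} ⊆ {w | (1 : ℝ) ≤ ‖w‖ ^ 2} := by
    intro w hw
    simp only [mem_setOf_eq] at hw ⊢
    nlinarith [hw]
  have hM := mul_meas_ge_le_integral_of_nonneg (μ := multivariateGaussian 0 S)
    (Eventually.of_forall fun w => by positivity) (integrable_norm_sq_gaussian S) 1
  rw [one_mul, integral_norm_sq_gaussian_eq_trace hS] at hM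
  exact (measureReal_mono hsub).trans hM

/-- `P_S(‖w‖ ≤ 1) ≥ 1 − tr S` for positive semidefinite `S`. [folklore] -/
private theorem one_sub_trace_le_measureReal_norm_le_one_gaussian {S : Matrix ι ι ℝ} (hS : S.PosSemidef) :
    1 - ∑ i, S i i ≤ (multivariateGaussian 0 S).real {w | ‖w‖ ≤ 1} := by
  have hc : {w : EuclideanSpace ℝ ι | ‖w‖ ≤ 1} = {w | 1 < ‖w‖}ᶜ := by
    ext w; simp
  have hmeas : MeasurableSet {w : EuclideanSpace ℝ ι | 1 < ‖w‖} :=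
    measurableSet_lt measurable_const measurable_norm
  rw [hc, measureReal_compl hmeas, probReal_univ]
  linarith [measureReal_one_lt_norm_gaussian_le_trace hS]

end Moments

/-! ### A local upper bound for the renormalised potentials after a restart time -/

section LocalBound

variable {N : ℕ} (D : CovDecomposition N) {V₀ : EuclideanSpace ℝ (Fin N) → ℝ}

/-- A measurable function with a uniform bound is integrable for a finite measure. [folklore] -/
private theorem integrable_of_abs_le' {α : Type*} [MeasurableSpace α] {μ : Measure α} [IsFiniteMeasure μ]
    {G : α → ℝ} (hG : Measurable G) {B : ℝ} (hB : ∀ x, |G x| ≤ B) : Integrable G μ :=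
  (integrable_const B).mono' hG.aestronglyMeasurable
    (Eventually.of_forall fun x => by rw [Real.norm_eq_abs]; exact hB x)

/-- `tr(C_t − C_a) → 0` as `t → a` (`a ≥ 0`; the entries of `C` are differentiable, hence continuous,
on `[0, ∞)`). [cite: BauerschmidtBodineauDagallier2023, §3.1] -/
theorem tendsto_trace_C_sub {a : ℝ} (ha : 0 ≤ a) :
    Tendsto (fun t => ∑ i, (D.C t - D.C a) i i) (𝓝 a) (𝓝 0) := by
  have h : ∀ i, Tendsto (fun t => (D.C t - D.C a) i i) (𝓝 a) (𝓝 0) := by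
    intro i
    have hc := ((D.hasDerivAt_C a ha i i).continuousAt.tendsto).sub_const (D.C a i i)
    rw [sub_self] at hc
    refine hc.congr fun t => ?_
    simp only [Matrix.sub_apply]
  have hs := tendsto_finsetSum (Finset.univ : Finset (Fin N)) fun i _ => h i
  rwa [Finset.sum_const_zero] at hs

variable (hV : Measurable V₀) {b : ℝ} (hb : ∀ φ, b ≤ V₀ φ)
include hV hb

/-- **Local upper bound after a restart time.**  If `V_a` is continuous (`a ≥ 0`), then for every
radius `R` there are `η > 0` and `S` with `V_t(ψ) ≤ S` for all `t ∈ [a, a+η]` and `‖ψ‖ ≤ R`: by the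
semigroup of potentials `e^{−V_t(ψ)} = E_{C_t−C_a}[e^{−V_a(ψ+ζ)}] ≥ e^{−max_{B(0,R+1)} V_a} P_{C_t−C_a}(‖ζ‖ ≤ 1)`
and Chebyshev `P_{C_t−C_a}(‖ζ‖ > 1) ≤ tr(C_t − C_a) ≤ ½` for `t` close to `a`.
[cite: BauerschmidtBodineauDagallier2023, Definition 2 / Lemma 2 (proof)] -/
theorem exists_renormPotential_le_near {a : ℝ} (ha : 0 ≤ a)
    (hcont : Continuous (renormPotential D V₀ a)) (R : ℝ) :
    ∃ η : ℝ, 0 < η ∧ ∃ S : ℝ, ∀ t ∈ Icc a (a + η), ∀ ψ : EuclideanSpace ℝ (Fin N), ‖ψ‖ ≤ R →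
      renormPotential D V₀ t ψ ≤ S := by
  -- an upper bound of the continuous `V_a` on the closed ball of radius `R + 1`
  obtain ⟨S₀, hS₀⟩ : ∃ S₀ : ℝ, ∀ x : EuclideanSpace ℝ (Fin N), ‖x‖ ≤ R + 1 →
      renormPotential D V₀ a x ≤ S₀ := by
    obtain ⟨S₀, hS₀⟩ := (isCompact_closedBall (0 : EuclideanSpace ℝ (Fin N)) (R + 1)).bddAbove_image
      hcont.continuousOn
    refine ⟨S₀, fun x hx => hS₀ ⟨x, ?_, rfl⟩⟩
    simpa using hx
  -- `tr(C_t − C_a) < 1/2` for `t` close to `a`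
  have hev : ∀ᶠ t in 𝓝 a, ∑ i, (D.C t - D.C a) i i < 1 / 2 :=
    (tendsto_order.1 (tendsto_trace_C_sub D ha)).2 _ (by norm_num)
  obtain ⟨η, hη, hball⟩ := Metric.eventually_nhds_iff.1 hev
  refine ⟨η / 2, by positivity, S₀ + Real.log 2, fun t ht ψ hψ => ?_⟩
  have hat : a ≤ t := ht.1
  have htr : ∑ i, (D.C t - D.C a) i i < 1 / 2 := by
    refine hball ?_
    rw [Real.dist_eq, abs_of_nonneg (by linarith [ht.1])]
    linarith [ht.2]
  have hPSD : (D.C t - D.C a).PosSemidef := D.posSemidef_C_sub ha hat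
  set P : Measure (EuclideanSpace ℝ (Fin N)) := multivariateGaussian 0 (D.C t - D.C a) with hP
  -- the restart identity `e^{−V_t(ψ)} = E_P[e^{−V_a(ψ+w)}]`
  have hid := exp_neg_renormPotential_eq_integral_sub D hV hb ha hat ψ
  -- lower bound of the integrand on the unit ball
  have hmeas : MeasurableSet {w : EuclideanSpace ℝ (Fin N) | ‖w‖ ≤ 1} :=
    measurableSet_le measurable_norm measurable_const
  have hint : Integrable (fun w => Real.exp (-renormPotential D V₀ a (ψ + w))) P :=
    integrable_of_abs_le' (((measurable_renormPotential D hV a).comp (measurable_const_add ψ)).neg.exp)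
      (B := Real.exp (-b)) fun w => by
        rw [abs_of_pos (Real.exp_pos _)]
        exact Real.exp_le_exp.2 (neg_le_neg (le_renormPotential D hV hb a _))
  have hlow : Real.exp (-S₀) * P.real {w | ‖w‖ ≤ 1} ≤
      ∫ w, Real.exp (-renormPotential D V₀ a (ψ + w)) ∂P := by
    have h1 : ∫ w, {w : EuclideanSpace ℝ (Fin N) | ‖w‖ ≤ 1}.indicator (fun _ => Real.exp (-S₀)) w ∂P =
        P.real {w | ‖w‖ ≤ 1} • Real.exp (-S₀) := integral_indicator_const _ hmeas
    rw [smul_eq_mul, mul_comm] at h1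
    rw [← h1]
    refine integral_mono ((integrable_const _).indicator hmeas) hint fun w => ?_
    by_cases hw : w ∈ {w : EuclideanSpace ℝ (Fin N) | ‖w‖ ≤ 1}
    · rw [indicator_of_mem hw]
      refine Real.exp_le_exp.2 (neg_le_neg (hS₀ _ ?_))
      have hw' : ‖w‖ ≤ 1 := hw
      calc ‖ψ + w‖ ≤ ‖ψ‖ + ‖w‖ := norm_add_le _ _
        _ ≤ R + 1 := add_le_add hψ hw'
    · rw [indicator_of_notMem hw]
      exact (Real.exp_pos _).le
  have hball1 : 1 / 2 ≤ P.real {w | ‖w‖ ≤ 1} := by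
    have h := one_sub_trace_le_measureReal_norm_le_one_gaussian hPSD
    have htr' : ∑ i, (D.C t - D.C a) i i ≤ 1 / 2 := htr.le
    rw [hP]
    linarith
  -- conclude
  have hexp : Real.exp (-(S₀ + Real.log 2)) ≤ Real.exp (-renormPotential D V₀ t ψ) := by
    have h2 : Real.exp (-(S₀ + Real.log 2)) = Real.exp (-S₀) * (1 / 2) := by
      rw [neg_add, Real.exp_add, Real.exp_neg (Real.log 2), Real.exp_log (by norm_num : (0:ℝ) < 2)]
      ring
    rw [h2, hid]
    exact le_trans (mul_le_mul_of_nonneg_left hball1 (Real.exp_pos _).le) hlow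
  have := Real.exp_le_exp.1 hexp
  linarith

end LocalBound

/-! ### A point of small second derivative on a segment -/

section Segment

variable {E : Type*} [NormedAddCommGroup E] [NormedSpace ℝ E]

/-- Derivative of `σ ↦ V(σ•w)`. [folklore] -/
private theorem hasDerivAt_comp_smul {V : E → ℝ} (hV : ContDiff ℝ 2 V) (w : E) (σ : ℝ) :
    HasDerivAt (fun τ : ℝ => V (τ • w)) (fderiv ℝ V (σ • w) w) σ := by
  have hl : HasDerivAt (fun τ : ℝ => τ • w) w σ := by
    simpa using (hasDerivAt_id σ).smul_const w
  exact ((hV.differentiable (by norm_num)) (σ • w)).hasFDerivAt.comp_hasDerivAt σ hl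

/-- Derivative of `σ ↦ DV(σ•w) w`. [folklore] -/
private theorem hasDerivAt_fderiv_comp_smul {V : E → ℝ} (hV : ContDiff ℝ 2 V) (w : E) (σ : ℝ) :
    HasDerivAt (fun τ : ℝ => fderiv ℝ V (τ • w) w) (fderiv ℝ (fderiv ℝ V) (σ • w) w w) σ := by
  have hl : HasDerivAt (fun τ : ℝ => τ • w) w σ := by
    simpa using (hasDerivAt_id σ).smul_const w
  have hd : Differentiable ℝ (fderiv ℝ V) :=
    (hV.fderiv_right (m := 1) (by norm_num)).differentiable (by norm_num)
  have hc : HasDerivAt (fun τ : ℝ => fderiv ℝ V (τ • w)) (fderiv ℝ (fderiv ℝ V) (σ • w) w) σ :=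
    (hd (σ • w)).hasFDerivAt.comp_hasDerivAt σ hl
  have h := (ContinuousLinearMap.apply ℝ ℝ w).hasFDerivAt.comp_hasDerivAt σ hc
  simpa only [Function.comp_def, ContinuousLinearMap.apply_apply] using h

/-- **A `C²` function bounded by `K` on the segment `[−w, w]` has, at some point of that segment, second
derivative at most `4K` in the direction `w`** (otherwise `σ ↦ V(σw) − 2Kσ²` is strictly convex on
`[−1, 1]`, forcing `V(w) + V(−w) − 2V(0) > 4K`). [folklore] -/
private theorem exists_fderiv_fderiv_le_of_abs_le {V : E → ℝ} (hV : ContDiff ℝ 2 V) (w : E) {K : ℝ}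
    (hK : ∀ σ ∈ Icc (-1 : ℝ) 1, |V (σ • w)| ≤ K) :
    ∃ σ ∈ Icc (-1 : ℝ) 1, fderiv ℝ (fderiv ℝ V) (σ • w) w w ≤ 4 * K := by
  by_contra! hcon
  -- `g σ = V(σw)`, `g₁ = g'`, `g₂ = g₁'`
  set g : ℝ → ℝ := fun σ => V (σ • w) with hg
  set g₁ : ℝ → ℝ := fun σ => fderiv ℝ V (σ • w) w with hg₁
  set g₂ : ℝ → ℝ := fun σ => fderiv ℝ (fderiv ℝ V) (σ • w) w w with hg₂
  have hgd : ∀ σ, HasDerivAt g (g₁ σ) σ := fun σ => hasDerivAt_comp_smul hV w σ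
  have hg₁d : ∀ σ, HasDerivAt g₁ (g₂ σ) σ := fun σ => hasDerivAt_fderiv_comp_smul hV w σ
  -- `h σ = g σ − 2Kσ²`, `h₁ = h'`
  set h : ℝ → ℝ := fun σ => g σ - 2 * K * σ ^ 2 with hh
  set h₁ : ℝ → ℝ := fun σ => g₁ σ - 4 * K * σ with hh₁
  have hhd : ∀ σ, HasDerivAt h (h₁ σ) σ := by
    intro σ
    have e := (hgd σ).fun_sub ((hasDerivAt_pow 2 σ).const_mul (2 * K))
    refine e.congr_deriv ?_
    simp only [hh₁]
    norm_num
    ring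
  have hh₁d : ∀ σ, HasDerivAt h₁ (g₂ σ - 4 * K) σ := by
    intro σ
    have e := (hg₁d σ).fun_sub ((hasDerivAt_id' σ).const_mul (4 * K))
    refine e.congr_deriv ?_
    ring
  -- `h₁` is strictly increasing on `[−1, 1]`
  have hmono : StrictMonoOn h₁ (Icc (-1 : ℝ) 1) := by
    refine strictMonoOn_of_deriv_pos (convex_Icc _ _)
      (fun σ _ => (hh₁d σ).continuousAt.continuousWithinAt) fun σ hσ => ?_
    rw [interior_Icc] at hσ
    rw [(hh₁d σ).deriv]
    linarith [hcon σ (Ioo_subset_Icc_self hσ)]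
  -- two mean values
  obtain ⟨cp, hcp, hcp'⟩ := exists_hasDerivAt_eq_slope h h₁ (by norm_num : (0:ℝ) < 1)
    (fun σ _ => (hhd σ).continuousAt.continuousWithinAt) fun σ _ => hhd σ
  obtain ⟨cm, hcm, hcm'⟩ := exists_hasDerivAt_eq_slope h h₁ (by norm_num : (-1:ℝ) < 0)
    (fun σ _ => (hhd σ).continuousAt.continuousWithinAt) fun σ _ => hhd σ
  have hlt : h₁ cm < h₁ cp :=
    hmono ⟨hcm.1.le, by linarith [hcm.2]⟩ ⟨by linarith [hcp.1], hcp.2.le⟩ (by linarith [hcm.2, hcp.1])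
  rw [hcp', hcm'] at hlt
  norm_num at hlt
  -- `h 1 + h (−1) − 2 h 0 > 0`, i.e. `g 1 + g (−1) − 2 g 0 > 4K`
  have h1 := hK 1 (by norm_num)
  have h2 := hK (-1) (by norm_num)
  have h3 := hK 0 (by norm_num)
  simp only [hh, hg] at hlt
  rw [abs_le] at h1 h2 h3
  simp only [one_smul] at h1
  simp only [zero_smul] at h3
  rw [neg_one_smul] at h2
  norm_num at hlt
  linarith [h1.1, h1.2, h2.1, h2.2, h3.1, h3.2]

end Segment

/-! ### Kernel rigidity -/

section Rigidity

variable {N : ℕ} (D : CovDecomposition N) {V₀ : EuclideanSpace ℝ (Fin N) → ℝ}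

/-- The quadratic form `t ↦ (x, Ċ_t x)` has derivative `(x, C̈_t x)` at every `t ≥ 0`.
[cite: BauerschmidtBodineauDagallier2023, §3.1 / Theorem 3 («`Ċ_t` differentiable for all `t`»)] -/
theorem hasDerivAt_quadForm_Cdot (x : Fin N → ℝ) {t : ℝ} (ht : 0 ≤ t) :
    HasDerivAt (fun s => x ⬝ᵥ (D.Cdot s *ᵥ x)) (x ⬝ᵥ (D.Cddot t *ᵥ x)) t := by
  have h1 : (fun s => x ⬝ᵥ (D.Cdot s *ᵥ x)) = fun s => ∑ i, ∑ j, x i * (D.Cdot s i j * x j) := by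
    funext s
    simp only [dotProduct, Matrix.mulVec, Finset.mul_sum]
  have h2 : x ⬝ᵥ (D.Cddot t *ᵥ x) = ∑ i, ∑ j, x i * (D.Cddot t i j * x j) := by
    simp only [dotProduct, Matrix.mulVec, Finset.mul_sum]
  rw [h1, h2]
  refine HasDerivAt.fun_sum fun i _ => HasDerivAt.fun_sum fun j _ => ?_
  exact ((D.hasDerivAt_Cdot t ht i j).mul_const (x j)).const_mul (x i)

/-- `Hess f(φ)(u,u)` as the second Fréchet derivative. [folklore] -/
private theorem hessQF_eq' (f : EuclideanSpace ℝ (Fin N) → ℝ) (φ u : EuclideanSpace ℝ (Fin N)) :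
    hessQF f φ u = fderiv ℝ (fderiv ℝ f) φ u u := by
  simp only [hessQF, iteratedFDeriv_two_apply, Matrix.cons_val_zero, Matrix.cons_val_one]

/-- `Hess f(φ)(cu, cu) = c² Hess f(φ)(u,u)` for the quadratic form `hessQF` of the typed multiscale
condition. [cite: BauerschmidtBodineauDagallier2023, §3.3 (the Hessian `Hess V_t` as a quadratic form)] -/
theorem hessQF_smul (f : EuclideanSpace ℝ (Fin N) → ℝ) (φ u : EuclideanSpace ℝ (Fin N)) (c : ℝ) :
    hessQF f φ (c • u) = c ^ 2 * hessQF f φ u := by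
  rw [hessQF_eq', hessQF_eq', map_smul, map_smul, smul_apply, smul_eq_mul, smul_eq_mul]
  ring

/-- The inner product `⟪v, Ċ v⟫` of the typed multiscale condition is the dot product `(x, Ċ x)` of the
coordinate vector `x = v` ([BBD]'s `(u, v)_C = Σ C_ij u_i v_j`, §3.1 p0012 L45–51).
[cite: BauerschmidtBodineauDagallier2023, §3.1 (e:C-form)] -/
theorem inner_toEuclideanLin_eq_dotProduct (A : Matrix (Fin N) (Fin N) ℝ) (x : Fin N → ℝ) :
    ⟪WithLp.toLp 2 x, Matrix.toEuclideanLin A (WithLp.toLp 2 x)⟫ = x ⬝ᵥ (A *ᵥ x) := by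
  rw [EuclideanSpace.inner_eq_star_dotProduct, star_trivial, dotProduct_comm]
  rfl

/-- The multiscale condition (e:assCt-mon) in coordinates: for `x : Fin N → ℝ`, `t > 0` and every `φ`,
`λ̇_t (x, Ċ_t x) ≤ Hess V_t(φ)(Ċ_t x, Ċ_t x) − ½ (x, C̈_t x)`.
[cite: BauerschmidtBodineauDagallier2023, Theorem 3 (e:assCt-mon)] -/
theorem MultiscaleCondition.dotProduct {lamdot : ℝ → ℝ} (hMS : MultiscaleCondition D V₀ lamdot)
    (φ : EuclideanSpace ℝ (Fin N)) {t : ℝ} (ht : 0 < t) (x : Fin N → ℝ) :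
    lamdot t * (x ⬝ᵥ (D.Cdot t *ᵥ x)) ≤
      hessQF (renormPotential D V₀ t) φ (WithLp.toLp 2 (D.Cdot t *ᵥ x)) -
        (1 / 2) * (x ⬝ᵥ (D.Cddot t *ᵥ x)) := by
  have h := hMS φ t ht (WithLp.toLp 2 x)
  rw [inner_toEuclideanLin_eq_dotProduct, inner_toEuclideanLin_eq_dotProduct] at h
  exact h

/-- A nonnegative function on `[0, ∞)` vanishing at an interior point has zero derivative there (Fermat).
[folklore] -/
private theorem deriv_eq_zero_of_nonneg_of_eq_zero {q : ℝ → ℝ} {q't t : ℝ} (ht : 0 < t)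
    (hq0 : ∀ s, 0 ≤ s → 0 ≤ q s) (hqt : q t = 0) (hd : HasDerivAt q q't t) : q't = 0 := by
  have hmin : IsLocalMin q t := by
    filter_upwards [Ioi_mem_nhds ht] with s hs
    rw [hqt]
    exact hq0 s (le_of_lt hs)
  exact hmin.hasDerivAt_eq_zero hd

/-- **Kernel rigidity of a covariance decomposition under the multiscale Bakry–Émery condition.**
Let `V₀` be measurable and bounded below, `V_t ∈ C²` for all `t > 0`, let the multiscale condition
(e:assCt-mon) hold for all `φ` with rates `λ̇_t`, and let `λ̇` be locally integrable on `[0, ∞)` (the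
hypotheses of [BBD] Theorem 3 as typed in `Polchinski.BauerschmidtBodineau_multiscaleBakryEmery`).  If the
quadratic form `(x, C_{t₀} x)` vanishes for ONE `t₀ > 0`, then `(x, C_s x) = 0` for EVERY `s ≥ 0`: no direction
of the decomposition can switch on at a positive time.  (Own argument of this file, see the module docstring;
not in [BBD], whose Theorem 3 is stated in this degenerate generality.)
[cite: BauerschmidtBodineauDagallier2023, Theorem 3 (setting §3.1 p0012 L56–61)] -/
theorem quadForm_C_eq_zero_of_eq_zero (hV : Measurable V₀) {b : ℝ} (hb : ∀ φ, b ≤ V₀ φ)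
    (hC2 : ∀ t, 0 < t → ContDiff ℝ 2 (renormPotential D V₀ t))
    {lamdot : ℝ → ℝ} (hMS : MultiscaleCondition D V₀ lamdot)
    (hli : ∀ t, 0 ≤ t → IntervalIntegrable lamdot volume 0 t)
    (x : Fin N → ℝ) {t₀ : ℝ} (ht₀ : 0 < t₀) (hx : x ⬝ᵥ (D.C t₀ *ᵥ x) = 0) {s : ℝ} (hs : 0 ≤ s) :
    x ⬝ᵥ (D.C s *ᵥ x) = 0 := by
  by_contra hne
  ---------------------------------------------------------------- the three quadratic forms
  obtain ⟨Q, hQ⟩ : ∃ Q : ℝ → ℝ, Q = fun t => x ⬝ᵥ (D.C t *ᵥ x) := ⟨_, rfl⟩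
  obtain ⟨q, hq⟩ : ∃ q : ℝ → ℝ, q = fun t => x ⬝ᵥ (D.Cdot t *ᵥ x) := ⟨_, rfl⟩
  obtain ⟨q', hq'⟩ : ∃ q' : ℝ → ℝ, q' = fun t => x ⬝ᵥ (D.Cddot t *ᵥ x) := ⟨_, rfl⟩
  have hQd : ∀ t, 0 ≤ t → HasDerivAt Q (q t) t := fun t ht => by
    rw [hQ, hq]; exact D.hasDerivAt_quadForm_C x ht
  have hqd : ∀ t, 0 ≤ t → HasDerivAt q (q' t) t := fun t ht => by
    rw [hq, hq']; exact hasDerivAt_quadForm_Cdot D x ht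
  have hq0 : ∀ t, 0 ≤ t → 0 ≤ q t := fun t ht => by
    rw [hq]; simpa using (D.posSemidef_Cdot t ht).dotProduct_mulVec_nonneg x
  have hQ0 : ∀ t, 0 ≤ t → 0 ≤ Q t := fun t ht => by
    rw [hQ]; simpa using (D.posSemidef_C ht).dotProduct_mulVec_nonneg x
  have hQmono : ∀ u v, 0 ≤ u → u ≤ v → Q u ≤ Q v := fun u v hu huv => by
    rw [hQ]; exact D.quadForm_C_mono x hu huv
  have hQc : ∀ t, 0 ≤ t → ContinuousAt Q t := fun t ht => (hQd t ht).continuousAt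
  have hqc : ∀ t, 0 ≤ t → ContinuousAt q t := fun t ht => (hqd t ht).continuousAt
  have hxQ : Q t₀ = 0 := by rw [hQ]; exact hx
  have hsQ : Q s ≠ 0 := by rw [hQ]; exact hne
  ---------------------------------------------------------------- `t₀ < s`, `Q s > 0`
  have hQs : 0 < Q s := lt_of_le_of_ne (hQ0 s hs) (Ne.symm hsQ)
  have ht₀s : t₀ < s := by
    by_contra! h
    have := hQmono s t₀ hs h
    rw [hxQ] at this
    linarith
  ---------------------------------------------------------------- the last zero `a` of `Q` on `[0, s]`
  set Z : Set ℝ := Icc 0 s ∩ Q ⁻¹' {0} with hZ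
  have hZne : Z.Nonempty := ⟨t₀, ⟨ht₀.le, ht₀s.le⟩, hxQ⟩
  have hZbdd : BddAbove Z := ⟨s, fun t ht => ht.1.2⟩
  have hZcl : IsClosed Z :=
    ContinuousOn.preimage_isClosed_of_isClosed
      (fun t ht => (hQc t ht.1).continuousWithinAt) isClosed_Icc isClosed_singleton
  set a : ℝ := sSup Z with ha_def
  have haZ : a ∈ Z := hZcl.csSup_mem hZne hZbdd
  have ha0 : 0 ≤ a := haZ.1.1
  have has : a ≤ s := haZ.1.2
  have hQa : Q a = 0 := haZ.2
  have ht₀a : t₀ ≤ a := le_csSup hZbdd ⟨⟨ht₀.le, ht₀s.le⟩, hxQ⟩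
  have ha_pos : 0 < a := lt_of_lt_of_le ht₀ ht₀a
  have ha_lt_s : a < s := by
    rcases eq_or_lt_of_le has with h | h
    · rw [h] at hQa; exact absurd hQa (ne_of_gt hQs)
    · exact h
  have hQpos : ∀ t, a < t → t ≤ s → 0 < Q t := by
    intro t hat hts
    rcases eq_or_lt_of_le (hQ0 t (ha0.trans hat.le)) with h | h
    · exact absurd (le_csSup hZbdd ⟨⟨ha0.trans hat.le, hts⟩, h.symm⟩) (not_le.2 hat)
    · exact h
  ---------------------------------------------------------------- `q = 0` on `(0, a)`, hence `q a = 0`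
  have hQzero : ∀ t, 0 ≤ t → t ≤ a → Q t = 0 := fun t ht hta =>
    le_antisymm (by rw [← hQa]; exact hQmono t a ht hta) (hQ0 t ht)
  have hqzero : ∀ t, 0 < t → t < a → q t = 0 := by
    intro t ht hta
    have hev : Q =ᶠ[𝓝 t] fun _ => (0 : ℝ) := by
      filter_upwards [Ioo_mem_nhds ht hta] with u hu
      exact hQzero u hu.1.le hu.2.le
    have h0 : HasDerivAt Q 0 t := (hasDerivAt_const t (0 : ℝ)).congr_of_eventuallyEq hev
    exact (hQd t ht.le).unique h0
  have hqa : q a = 0 := by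
    have h1 : Tendsto q (𝓝[<] a) (𝓝 (q a)) := (hqc a ha0).tendsto.mono_left nhdsWithin_le_nhds
    have h2 : Tendsto q (𝓝[<] a) (𝓝 0) := by
      refine (tendsto_const_nhds (x := (0 : ℝ))).congr' ?_
      filter_upwards [Ioo_mem_nhdsLT (half_lt_self ha_pos)] with u hu
      exact (hqzero u (lt_trans (half_pos ha_pos) hu.1) hu.2).symm
    exact tendsto_nhds_unique h1 h2
  ---------------------------------------------------------------- the local bound (E1) at the restart time `a`
  obtain ⟨M, hM⟩ := D.bounded_Cdot
  set T : ℝ := ∑ _i : Fin N, M with hT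
  set R : ℝ := max T 1 with hR
  obtain ⟨η, hη, S, hS⟩ := exists_renormPotential_le_near D hV hb ha0 (hC2 a ha_pos).continuous R
  set K : ℝ := max |b| |S| with hK
  have hK0 : 0 ≤ K := le_trans (abs_nonneg b) (le_max_left _ _)
  have habs : ∀ t ∈ Icc a (a + η), ∀ ψ : EuclideanSpace ℝ (Fin N), ‖ψ‖ ≤ R →
      |renormPotential D V₀ t ψ| ≤ K := by
    intro t ht ψ hψ
    rw [abs_le]
    constructor
    · have h1 := le_renormPotential D hV hb t ψ
      have h2 : -K ≤ b := by
        have := neg_abs_le b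
        linarith [le_max_left |b| |S|]
      linarith
    · exact le_trans (hS t ht ψ hψ) (le_trans (le_abs_self S) (le_max_right _ _))
  ---------------------------------------------------------------- the differential inequality on `(a, a + η']`
  set η' : ℝ := min η (s - a) with hη'
  have hη'0 : 0 < η' := lt_min hη (by linarith)
  have hη'η : η' ≤ η := min_le_left _ _
  have hη's : a + η' ≤ s := by
    have := min_le_right η (s - a); linarith
  have htrace : ∀ t, 0 ≤ t → ∑ i, D.Cdot t i i ≤ T := by
    intro t ht
    exact Finset.sum_le_sum fun i _ => le_trans (le_abs_self _) (hM t ht i i)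
  have hdiff : ∀ t, a < t → t ≤ a + η' → q' t ≤ 2 * (4 * K - lamdot t) * q t := by
    intro t hat hta
    have ht0 : 0 < t := ha_pos.trans hat
    have htI : t ∈ Icc a (a + η) := ⟨hat.le, by linarith⟩
    rcases eq_or_lt_of_le (hq0 t ht0.le) with hqt | hqt
    · -- `q t = 0`: both sides vanish (Fermat)
      have hz : q' t = 0 := deriv_eq_zero_of_nonneg_of_eq_zero ht0 hq0 hqt.symm (hqd t ht0.le)
      rw [hz, ← hqt, mul_zero]
    · -- `q t > 0`: the multiscale condition at a point of small Hessian on the segment of `w_t`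
      set y : Fin N → ℝ := D.Cdot t *ᵥ x with hy
      set c : ℝ := Real.sqrt (q t) with hc
      have hc0 : 0 < c := Real.sqrt_pos.2 hqt
      have hcsq : c ^ 2 = q t := Real.sq_sqrt hqt.le
      set w : EuclideanSpace ℝ (Fin N) := c⁻¹ • WithLp.toLp 2 y with hw
      -- `‖w‖ ≤ R`
      have hy2 : ∑ i, y i ^ 2 ≤ T * q t := by
        have h1 := sum_mulVec_sq_le_trace_mul_quadForm (D.posSemidef_Cdot t ht0.le) x
        have h2 : (∑ i, D.Cdot t i i) * (x ⬝ᵥ (D.Cdot t *ᵥ x)) ≤ T * (x ⬝ᵥ (D.Cdot t *ᵥ x)) :=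
          mul_le_mul_of_nonneg_right (htrace t ht0.le) (by have := hq0 t ht0.le; rw [hq] at this; exact this)
        have e : x ⬝ᵥ (D.Cdot t *ᵥ x) = q t := by rw [hq]
        rw [e] at h1 h2
        exact h1.trans h2
      have hwn : ‖w‖ ≤ R := by
        have hn2 : ‖w‖ ^ 2 ≤ T := by
          rw [hw, norm_smul, mul_pow, norm_inv, Real.norm_eq_abs, abs_of_pos hc0, inv_pow, hcsq,
            EuclideanSpace.real_norm_sq_eq]
          rw [inv_mul_le_iff₀ hqt, mul_comm]
          exact hy2
        rcases le_or_gt ‖w‖ 1 with h1 | h1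
        · exact h1.trans (le_max_right _ _)
        · have : ‖w‖ ≤ ‖w‖ ^ 2 := by nlinarith
          exact this.trans (hn2.trans (le_max_left _ _))
      -- a point `σ • w` with `Hess V_t(σw)(w,w) ≤ 4K`
      have hseg : ∀ σ ∈ Icc (-1 : ℝ) 1, |renormPotential D V₀ t (σ • w)| ≤ K := by
        intro σ hσ
        refine habs t htI _ ?_
        calc ‖σ • w‖ = |σ| * ‖w‖ := by rw [norm_smul, Real.norm_eq_abs]
          _ ≤ 1 * ‖w‖ := mul_le_mul_of_nonneg_right (abs_le.2 ⟨by linarith [hσ.1], hσ.2⟩) (norm_nonneg _)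
          _ ≤ R := by rw [one_mul]; exact hwn
      obtain ⟨σ, -, hσ⟩ := exists_fderiv_fderiv_le_of_abs_le (hC2 t ht0) w hseg
      rw [← hessQF_eq'] at hσ
      -- the multiscale condition at `φ = σ • w`
      have hms := MultiscaleCondition.dotProduct D hMS (σ • w) ht0 x
      have hyw : WithLp.toLp 2 (D.Cdot t *ᵥ x) = c • w := by
        rw [hw, smul_inv_smul₀ hc0.ne']
      rw [hyw, hessQF_smul, hcsq] at hms
      have e1 : x ⬝ᵥ (D.Cdot t *ᵥ x) = q t := by rw [hq]
      have e2 : x ⬝ᵥ (D.Cddot t *ᵥ x) = q' t := by rw [hq']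
      rw [e1, e2] at hms
      have h4 : q t * hessQF (renormPotential D V₀ t) (σ • w) w ≤ q t * (4 * K) :=
        mul_le_mul_of_nonneg_left hσ hqt.le
      nlinarith
  ---------------------------------------------------------------- a point `m ∈ (a, a+η')` with `q m > 0`
  obtain ⟨m, hm, hqm⟩ : ∃ m ∈ Ioo a (a + η'), 0 < q m := by
    obtain ⟨m, hm, hm'⟩ := exists_hasDerivAt_eq_slope Q q (by linarith : a < a + η')
      (fun t ht => (hQc t (ha0.trans ht.1)).continuousWithinAt)
      (fun t ht => hQd t (ha0.trans ht.1.le))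
    refine ⟨m, hm, ?_⟩
    rw [hm', hQa, sub_zero]
    exact div_pos (hQpos _ (by linarith) hη's) (by linarith)
  ---------------------------------------------------------------- the last zero `z` of `q` on `[a, m]`
  set Z' : Set ℝ := Icc a m ∩ q ⁻¹' {0} with hZ'
  have hZ'ne : Z'.Nonempty := ⟨a, ⟨le_rfl, hm.1.le⟩, hqa⟩
  have hZ'bdd : BddAbove Z' := ⟨m, fun t ht => ht.1.2⟩
  have hZ'cl : IsClosed Z' :=
    ContinuousOn.preimage_isClosed_of_isClosed
      (fun t ht => (hqc t (ha0.trans ht.1)).continuousWithinAt) isClosed_Icc isClosed_singleton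
  set z : ℝ := sSup Z' with hz_def
  have hzZ : z ∈ Z' := hZ'cl.csSup_mem hZ'ne hZ'bdd
  have haz : a ≤ z := hzZ.1.1
  have hzm : z ≤ m := hzZ.1.2
  have hqz : q z = 0 := hzZ.2
  have hz_lt_m : z < m := by
    rcases eq_or_lt_of_le hzm with h | h
    · rw [h] at hqz; exact absurd hqz (ne_of_gt hqm)
    · exact h
  have hqpos : ∀ t, z < t → t ≤ m → 0 < q t := by
    intro t hzt htm
    rcases eq_or_lt_of_le (hq0 t (ha0.trans (haz.trans hzt.le))) with h | h
    · exact absurd (le_csSup hZ'bdd ⟨⟨haz.trans hzt.le, htm⟩, h.symm⟩) (not_le.2 hzt)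
    · exact h
  ---------------------------------------------------------------- (E3) the logarithmic Grönwall step on `(z, m]`
  -- the integrable majorant `β = 2(4K − λ̇)` and the constant `Kβ = ∫_{[0,m]} |β|`
  set β : ℝ → ℝ := fun t => 2 * (4 * K - lamdot t) with hβ
  have hm0 : 0 ≤ m := ha0.trans hm.1.le
  have hβint : IntegrableOn β (Icc 0 m) := by
    have hl : IntegrableOn lamdot (Icc 0 m) :=
      (intervalIntegrable_iff_integrableOn_Icc_of_le hm0).1 (hli m hm0)
    have h1 : IntegrableOn (fun t => 4 * K - lamdot t) (Icc 0 m) :=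
      (integrableOn_const (hs := by rw [Real.volume_Icc]; exact ENNReal.ofReal_ne_top)).sub hl
    exact h1.const_mul 2
  set Kβ : ℝ := ∫ t in Icc 0 m, |β t| with hKβ
  have hlog : ∀ t₁, z < t₁ → t₁ < m → Real.log (q m) - Real.log (q t₁) ≤ Kβ := by
    intro t₁ hzt htm
    have ht₁0 : 0 ≤ t₁ := ha0.trans (haz.trans hzt.le)
    have hsub : Icc t₁ m ⊆ Icc 0 m := Icc_subset_Icc ht₁0 le_rfl
    have hderiv : ∀ u ∈ Ioo t₁ m, HasDerivWithinAt (fun v => Real.log (q v)) (q' u / q u) (Ioi u) u := by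
      intro u hu
      have hu0 : 0 ≤ u := ht₁0.trans hu.1.le
      exact ((hqd u hu0).log (ne_of_gt (hqpos u (hzt.trans hu.1) hu.2.le))).hasDerivWithinAt
    have hcont : ContinuousOn (fun v => Real.log (q v)) (Icc t₁ m) := by
      intro u hu
      have hu0 : 0 ≤ u := ht₁0.trans hu.1
      exact ((hqc u hu0).log (ne_of_gt (hqpos u (lt_of_lt_of_le hzt hu.1) hu.2))).continuousWithinAt
    have hle : ∀ u ∈ Ioo t₁ m, q' u / q u ≤ β u := by
      intro u hu
      have hqu := hqpos u (hzt.trans hu.1) hu.2.le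
      rw [div_le_iff₀ hqu]
      exact hdiff u (lt_of_le_of_lt haz (hzt.trans hu.1)) (by linarith [hu.2, hm.2])
    have hFTC := intervalIntegral.sub_le_integral_of_hasDeriv_right_of_le htm.le hcont hderiv
      (hβint.mono_set hsub) hle
    -- `∫_{t₁}^{m} β ≤ Kβ`
    have hI : ∫ u in t₁..m, β u ≤ Kβ := by
      rw [intervalIntegral.integral_of_le htm.le]
      have hβIoc : IntegrableOn β (Ioc t₁ m) := hβint.mono_set (Ioc_subset_Icc_self.trans hsub)
      calc ∫ u in Ioc t₁ m, β u ≤ ∫ u in Ioc t₁ m, |β u| :=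
            integral_mono hβIoc hβIoc.abs fun u => le_abs_self _
        _ ≤ ∫ u in Icc 0 m, |β u| :=
            setIntegral_mono_set hβint.abs (Eventually.of_forall fun u => abs_nonneg _)
              (Eventually.of_forall (Ioc_subset_Icc_self.trans hsub))
    exact hFTC.trans hI
  -- hence `q ≥ q(m) e^{−Kβ} > 0` on `(z, m)`
  have hlow : ∀ t₁, z < t₁ → t₁ < m → q m * Real.exp (-Kβ) ≤ q t₁ := by
    intro t₁ hzt htm
    have hq1 := hqpos t₁ hzt htm.le
    have h := hlog t₁ hzt htm
    have h' : Real.log (q m) - Kβ ≤ Real.log (q t₁) := by linarith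
    have := Real.exp_le_exp.2 h'
    rwa [Real.exp_sub, Real.exp_log hqm, Real.exp_log hq1, div_eq_mul_inv, ← Real.exp_neg] at this
  ---------------------------------------------------------------- contradiction at `z`
  have hlim : Tendsto q (𝓝[>] z) (𝓝 (q z)) :=
    (hqc z (ha0.trans haz)).tendsto.mono_left nhdsWithin_le_nhds
  have hge : q m * Real.exp (-Kβ) ≤ q z := by
    refine ge_of_tendsto hlim ?_
    filter_upwards [Ioo_mem_nhdsGT hz_lt_m] with u hu
    exact hlow u hu.1 hu.2
  rw [hqz] at hge
  linarith [mul_pos hqm (Real.exp_pos (-Kβ))]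

/-- **Kernel rigidity, `ker` form**: under the same hypotheses, `C_t x = 0` for one `t > 0` iff
`C_∞ x = 0` (for positive semidefinite matrices `(x, Ax) = 0 ↔ Ax = 0`, and `(x, C_s x) → (x, C_∞ x)`).
[cite: BauerschmidtBodineauDagallier2023, Theorem 3 (setting §3.1)] -/
theorem mulVec_C_eq_zero_iff_mulVec_Cinf_eq_zero (hV : Measurable V₀) {b : ℝ} (hb : ∀ φ, b ≤ V₀ φ)
    (hC2 : ∀ t, 0 < t → ContDiff ℝ 2 (renormPotential D V₀ t))
    {lamdot : ℝ → ℝ} (hMS : MultiscaleCondition D V₀ lamdot)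
    (hli : ∀ t, 0 ≤ t → IntervalIntegrable lamdot volume 0 t)
    (x : Fin N → ℝ) {t : ℝ} (ht : 0 < t) :
    D.C t *ᵥ x = 0 ↔ D.Cinf *ᵥ x = 0 := by
  constructor
  · intro h
    have hq : x ⬝ᵥ (D.C t *ᵥ x) = 0 := by rw [h, dotProduct_zero]
    have hall : ∀ s, 0 ≤ s → x ⬝ᵥ (D.C s *ᵥ x) = 0 := fun s hs =>
      quadForm_C_eq_zero_of_eq_zero D hV hb hC2 hMS hli x ht hq hs
    have hlim : x ⬝ᵥ (D.Cinf *ᵥ x) = 0 := by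
      refine tendsto_nhds_unique (D.tendsto_quadForm_C x) ?_
      refine (tendsto_const_nhds (x := (0 : ℝ))).congr' ?_
      filter_upwards [eventually_ge_atTop (0 : ℝ)] with s hs
      exact (hall s hs).symm
    have h0 := (D.posSemidef_Cinf.dotProduct_mulVec_zero_iff x).1 (by simpa using hlim)
    exact h0
  · intro h
    have hq : x ⬝ᵥ (D.Cinf *ᵥ x) = 0 := by rw [h, dotProduct_zero]
    have hle : x ⬝ᵥ (D.C t *ᵥ x) ≤ x ⬝ᵥ (D.Cinf *ᵥ x) := by
      have h' := (D.posSemidef_Cinf_sub ht.le).dotProduct_mulVec_nonneg x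
      rw [star_trivial, Matrix.sub_mulVec, dotProduct_sub] at h'
      linarith
    have hge : 0 ≤ x ⬝ᵥ (D.C t *ᵥ x) := by
      simpa using (D.posSemidef_C ht.le).dotProduct_mulVec_nonneg x
    have hz : x ⬝ᵥ (D.C t *ᵥ x) = 0 := le_antisymm (by rw [hq] at hle; exact hle) hge
    exact (D.posSemidef_C ht.le).dotProduct_mulVec_zero_iff x |>.1 (by simpa using hz)

end Rigidity

end Polchinski

end Literature.Analysis.FunctionSpaces

end
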